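import Mathlib
import Summits.Ventures.FusionMHD.Models.CerfonFreidbergIterLikeQHalfMercDefs
import HarnessLib

/-!
# Ventures/FusionMHD — Models/CerfonFreidbergIterLikeQHalfMercPanels2.lean: KERNEL CHECK of the Mercier-register certificates of panel(s) 1 (of 32)
# at `ψ_N = 1/2` of THE Cerfon–Freidberg ITER-like instance

HONEST FRAMING (LADDER-GRIDFUSION three columns; CF rung; «F2.R2-CF-MERCIER-IMPLICIT» step (2), F2-SCOPING v1.6 §10(c)).  One `decide +kernel` (≈ 70 s): for each
listed panel the obligation `CFIterLike.QHalfMerc.MercCert.ok` (`Models/CerfonFreidbergIterLikeQHalfMercDefs.lean`) — the Taylor-model run of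
`progM = progA ++ block1 ++ block2 ++ block3M` over ★ #117's parameter box is ACCEPTED (both `inv` certificates included) and the kernel's FOUR panel-integral
enclosures (`g_W`, `g_Aσ`, `g_AR`, `g_B1` along the approximant) lie inside the claimed integers (read off a compiled `#eval` of the same functions, slack one unit of
`2⁻⁶⁰`; float truth inside every panel, `HOME/models/model-7/g7/genqm/truthM.json`).  MODELLED: analytic Cerfon–Freidberg family; nothing about a device or
stability.  No `native_decide`.  Typer/prover: gridfusion-model-7 (g7), 2026-08-27.
Citations: Jardin 2010 §8.5 (8.134) [Jardin2010]; Mahboubi–Melquiond–Sibut-Pinote 2016 §3.2 Lemma 3 [MahboubiMelquiondSibutpinote2016].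
-/

namespace Summit.Ventures.FusionMHD.Models.CFIterLike.QHalfMerc

/-- Mercier-register certificate data of panel(s) 1. [instance data] -/
def mercCert2 : List MercCert := [
  { j := 1, cand1 := [95941115408989028352, 61921015120728711168, 685209230057787228160, 535893126104702582784, 3089244632611704274944, 3040003000504731828224, 12277496457252078354432, 11801908151226877345792, 2434351252765965025280, 7349826291278836567900160, 169661101115679995668201472, -9254086214289254499873718272, -262072683486954066977860091904],
    cand2 := [118714109347717496832, 44387063580984197120, 490529712164639145984, 370469288523856543744, 2147466412707588341760, 2259634614156463177728, 9165758932403312656384, 8819317853485085491200, 1383597059771228749824, 7529164997439053488979968, 207220388928588515685433344, -10354943417834675026152914944, -374096281700198224876625985536],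
    deg := 12, e1 := 41, e2 := 41, wlo := -241389982781887716, whi := -241389914117083115, slo := 3627043832488756525, shi := 3627043984636962378,
    rlo := 5614418468582283608, rhi := 5614418711025562793, blo := 2343155039546207908, bhi := 2343155135182933135 }]

/-- **KERNEL CHECK** of the four Mercier registers on panel(s) 1. -/
theorem mercCert2_ok : CFIterLike.QHalfMerc.mercCert2.all MercCert.ok = true := by
  decide +kernel

end Summit.Ventures.FusionMHD.Models.CFIterLike.QHalfMerc
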